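import Summits.Ventures.QEC.Census.BB.BB144.BZAutMitmZ00a
import Summits.Ventures.QEC.Census.BB.BB144.BZAutMitmZ00b
import Summits.Ventures.QEC.Census.BB.BB144.BZAutMitmZ00c
import HarnessLib

/-!
# `BB144` — meet-in-the-middle replay of the `bz_aut` enumeration matrices, side Z, block 0 (matrix 1, parts 12–14 + block collector)

Matrix 1 (depth 5) of block 0: parts 12–14 (layer 5, groups 3–5), and the collector `bzAutMitmZ_0` over both matrices and all parts.

KERNEL tier (`decide +kernel`, axioms standard): each theorem states that one PART of the meet-in-the-middle replay
(`Census/CertCheckBZMitm.lean`, `DistCert.bzZMitm`) of one enumeration matrix of block 0 of the `bz_aut` certificate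
`7c1e929a56946658` of `[[144,12,12]]` (`BB144.bzAutData`, emitted by qec-search-7) passes: part 0 = layers 1–2 + group
side conditions, part 1 = layer 3 (direct), parts 2–8 = layer 4 on the 7 redundancy-column groups, parts 9–14 = layer 5
on the 6 groups (vacuous for a depth-4 matrix).  With the soundness theorem of `Census/CertCheckBZMitmSound.lean`
these replace the `native_decide` enumeration verdicts (`BZAutEnumZ*.lean`) of the same matrices by KERNEL-checked
ones; no distance value is asserted here.  Generated by HOME/census/search-9/bzmitm/gen_parts.py (qec-search-9).
-/

namespace Summit.Ventures.QEC.Census.BB144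

open Summit.Ventures.QEC.Census

set_option maxHeartbeats 4000000 in
/-- `bz_aut` certificate `7c1e929a`, side Z, block 0, matrix 1: part 12 of the meet-in-the-middle replay passes. -/
theorem bzAutMitmZ_0_1_12 : cert.bzZMitm bzAutData 0 1 12 = true := by
  decide +kernel

set_option maxHeartbeats 4000000 in
/-- `bz_aut` certificate `7c1e929a`, side Z, block 0, matrix 1: part 13 of the meet-in-the-middle replay passes. -/
theorem bzAutMitmZ_0_1_13 : cert.bzZMitm bzAutData 0 1 13 = true := by
  decide +kernel

set_option maxHeartbeats 4000000 in
/-- `bz_aut` certificate `7c1e929a`, side Z, block 0, matrix 1: part 14 of the meet-in-the-middle replay passes. -/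
theorem bzAutMitmZ_0_1_14 : cert.bzZMitm bzAutData 0 1 14 = true := by
  decide +kernel

/-- **Block 0, side Z**: every part of the meet-in-the-middle replay of both enumeration matrices passes. -/
theorem bzAutMitmZ_0 : ∀ i, i < 2 → ∀ p, p < 15 → cert.bzZMitm bzAutData 0 i p = true := by
  intro i hi p hp
  interval_cases i <;> interval_cases p
  · exact bzAutMitmZ_0_0_0
  · exact bzAutMitmZ_0_0_1
  · exact bzAutMitmZ_0_0_2
  · exact bzAutMitmZ_0_0_3
  · exact bzAutMitmZ_0_0_4
  · exact bzAutMitmZ_0_0_5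
  · exact bzAutMitmZ_0_0_6
  · exact bzAutMitmZ_0_0_7
  · exact bzAutMitmZ_0_0_8
  · exact bzAutMitmZ_0_0_9
  · exact bzAutMitmZ_0_0_10
  · exact bzAutMitmZ_0_0_11
  · exact bzAutMitmZ_0_0_12
  · exact bzAutMitmZ_0_0_13
  · exact bzAutMitmZ_0_0_14
  · exact bzAutMitmZ_0_1_0
  · exact bzAutMitmZ_0_1_1
  · exact bzAutMitmZ_0_1_2
  · exact bzAutMitmZ_0_1_3
  · exact bzAutMitmZ_0_1_4
  · exact bzAutMitmZ_0_1_5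
  · exact bzAutMitmZ_0_1_6
  · exact bzAutMitmZ_0_1_7
  · exact bzAutMitmZ_0_1_8
  · exact bzAutMitmZ_0_1_9
  · exact bzAutMitmZ_0_1_10
  · exact bzAutMitmZ_0_1_11
  · exact bzAutMitmZ_0_1_12
  · exact bzAutMitmZ_0_1_13
  · exact bzAutMitmZ_0_1_14

end Summit.Ventures.QEC.Census.BB144
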